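import Summits.BirchSwinnertonDyer.BirchSwinnertonDyer.Theorems.SignedLowerHalvesKobayashiMainConjectureKeyingDoorShapes
import HarnessLib

/-!
# Route `SignedLowerHalves` (K3), cruxes 2–4 (items stmt-BirchSwinnertonDyer-19000/19001/19002): THE KEYING DOOR, part 2 —
# `KobayashiMainConjecture W p ε`, `KobayashiLowerDivisibility W p ε` and the `p`-inverted `λ`-shape of child 23118
# are EQUIVALENT to their contragredient (print-keyed) twins, UNCONDITIONALLY at every odd good `p` with `a_p = 0`

Cell `bsd-ssimc`, seat `bsd-line-slh-p3` LEAD gen 12 (helper file `--supports stmt-BirchSwinnertonDyer-19002`). Part 1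
(`…KobayashiMainConjectureKeyingDoorShapes.lean`) supplies the functional equation `ι(L_p^ε) = u · L_p^ε` (§1 there, a
THEOREM from `Sprung2017.cor414_sharpFlat_functionalEquation_apZero_holds` on a Pollack pair) and the shape algebra;
the dictionary is `Kobayashi2003/SignedSelmerDualInvolutionTwistProofs.lean` (width seat `bsd-line-slh-p1-w7` + §4).
HONEST FRAMING: THEOREMS ONLY — no definition (the contragredient twins are written out, not named), no named fact, no
instance, no `sorry`; route-independent (no `Theses` import); closes no item; the doors are `↔`/conditional statements
and credit nothing toward any item; BSD / cruxes 2–5 are NOT proved by any of this.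

## Why

The K3 deciding statements quantify over the tree's KEY-`γ` signed dual data `SignedSelmerDualData W κ γ ε`
(PRE-composition convention) at the pinned cyclotomic variable `γ`; a print source states them for the Pontryagin
dual with the contragredient `Γ`-action, i.e. for the tree's key-`γ⁻¹` data. Director ruling (266)/R1′ after the
crux-5 keying finding asked whether cruxes 2–4 are affected; the pen's reading (S35-8, ref R-273, lit (L4)) was
«ι-SAFE at `a_p = 0` because each signed ideal `(L_p^ε)` is separately `ι`-stable». This file makes that reading a
kernel fact: each statement is EQUIVALENT to its contragredient twin, so whichever convention a print source for
cruxes 2–4 uses, it lands on the K3 decl through one of these doors; no re-keying item, no `_contra` sibling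
definition and no route re-bind is needed on the Kobayashi side (contrast: crux 5's ♯/♭ leaf, p660336 / p662508).

## What is proved (hypotheses: `p ≠ 2`, good reduction at `p`, `a_p = 0`; `κ`, `γ`, `f`, `ϖ`, the Pollack pair as in the defs)

* `kobayashiMainConjecture_iff_contra` (+ `kobayashiMainConjecture_of_contra`): Kobayashi's main conjecture for
  `(W, p, ε)` ⟺ the same text over `D′ : SignedSelmerDualData W κ γ⁻¹ ε`;
* `kobayashiLowerDivisibility_iff_contra` (+ `kobayashiLowerDivisibility_of_contra`): the Eisenstein half likewise;
* `lambdaLowerShape_iff_contra`: the `p`-inverted `λ`-shape (body of child 23118 `SmallImageLambdaLowerAtThree` / of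
  crux 3's `p = 3` residual, one `(W, p, ε)`) likewise, same exponent `m`;
* §4 (appended) **the INPUT side**: Kobayashi's Thm. 4.1 conclusions are keying-invariant too —
  `pow_mul_kobayashiL_mem_charIdeal_iff_contra` (`pⁿ L_p^ε ∈ char X^ε` for a key-`γ` datum ⟺ for a key-`γ⁻¹` datum),
  `kobayashiL_mem_charIdeal_iff_contra` (`n = 0`), `exists_pow_mul_kobayashiL_mem_charIdeal_iff_contra` — so the Pub
  bundle's `Kobayashi2003.thm41_signedCharIdeal_divisibility` (typed on key-`γ` data) needs no `_contra` sibling either;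
* `exists_sign_kobayashiMainConjecture_iff_contra_of_classX7`: on crux 4's domain (`ClassX7 W p`, `p ≠ 2`, `a_p = 0`)
  the conclusion `∃ ε, KobayashiMainConjecture W p ε` of `Theses.SignedLowerHalves.KobayashiMainConjectureSmallImage` is
  equivalent to its contragredient twin.

References: [Kobayashi2003] Def. 1.1, Conjecture (p. 2), Thm. 4.1; [Sprung2017] Cor. 4.14 (a_p = 0 display);
[MazurTateTeitelbaum1986Invent] Ch. I §17; [GreenbergLNM1716] §1 pp. 60, 67–68; [Greenberg1989] §0 pp. 101–102;
[Kato2004Asterisque] §13.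
-/

set_option autoImplicit false
set_option linter.dupNamespace false

noncomputable section

open scoped Classical MatrixGroups ModularForm

open CongruenceSubgroup PowerSeries WeierstrassCurve Literature.NumberTheory.EllipticCurves
  Literature.NumberTheory.EllipticCurves.ModularForms Literature.Barriers.BirchSwinnertonDyer
  Literature.NumberTheory.EllipticCurves.Rank1Residual Literature.NumberTheory.EllipticCurves.Sprung2017
  Literature.NumberTheory.EllipticCurves.Kobayashi2003 ZpExtension
  Literature.NumberTheory.EllipticCurves.IwasawaAlgebra
  Summit.BirchSwinnertonDyer.Rank1Residual.Supersingular
  Summit.BirchSwinnertonDyer.BirchSwinnertonDyer.Theorems.SignedKatoOffTwo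

namespace Summit.BirchSwinnertonDyer.BirchSwinnertonDyer.Theorems.KobayashiKeyingDoor

/-! ## §3. The doors for the named K3 statements -/

section Doors

variable (W : WeierstrassCurve ℚ) [W.IsElliptic] [W.IsGloballyMinimal] (p : ℕ) [Fact p.Prime] (ε : ℤˣ)

/-- **KEYING DOOR FOR KOBAYASHI'S MAIN CONJECTURE.** At an odd good prime `p` with `a_p = 0`,
`KobayashiMainConjecture W p ε` (every KEY-`γ` dual datum at the pinned cyclotomic variable: `X^ε` torsion and
`char X^ε = (g)` with `g^ℚ = ϖ · (L_p^ε)^ℚ`) is EQUIVALENT to the same statement over the CONTRAGREDIENT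
(print-keyed) data `D′ : SignedSelmerDualData W κ γ⁻¹ ε`. Door = dictionary (`signedSelmerDualData_isTorsion_inv_iff`,
`…_charIdeal_inv_eq_span_iff`) + the functional equation `ι(L_p^ε) = u L_p^ε` (§1, a theorem). So the K3 cruxes
2–4, which conclude `KobayashiMainConjecture … ε` / `∃ ε, …`, are insensitive to the keying convention of their
print sources (contrast: crux 5's ♯/♭ leaf, negative lemma p660336). UNCONDITIONAL.
[cite: Kobayashi2003, Conjecture (Main Conjecture) (p. 2) and Def. 1.1] [cite: Sprung2017, Cor. 4.14 (a_p = 0 display)]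
[cite: GreenbergLNM1716, §1 (pp. 60, 67–68)] -/
theorem kobayashiMainConjecture_iff_contra (hp : p ≠ 2) (hgood : W.HasGoodReductionAtPrime p)
    (hap : W.frobeniusTrace p = 0) :
    KobayashiMainConjecture W p ε ↔
      ∀ (κ : ZpExtension ℚ p) (γ : Field.absoluteGaloisGroup ℚ),
          κ.IsCyclotomic → κ.IsTopGenerator γ → IsCyclotomicVariable p γ →
        ∀ [NeZero (W.conductorNorm ℤ)] (f : CuspForm (Gamma0 (W.conductorNorm ℤ)) 2),
          IsNewformOf W f → ∀ (ϖ : ℚ), (ϖ : ℝ) * W.realPeriodRat = plusPeriod f →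
        ∀ (Lplus Lminus : IwasawaAlgebra p), IsPollackPair f p Lplus Lminus →
        ∀ (D' : SignedSelmerDualData W κ γ⁻¹ ε), Module.IsTorsion (IwasawaAlgebra p) D'.X ∧
          ∃ g : IwasawaAlgebra p, D'.charIdeal = Ideal.span {g} ∧
            iwasawaToPowerSeries p g =
              PowerSeries.C (ϖ : ℚ_[p]) * iwasawaToPowerSeries p (kobayashiL ε Lplus Lminus) := by
  constructor
  · intro h κ γ hκ hγ hγ' _ f hf ϖ hϖ Lplus Lminus hPP D'
    obtain ⟨u, hu, hFE⟩ := exists_isUnit_invol_kobayashiL_eq_mul hp hgood hap hf hPP ε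
    exact mcShape_inv_of hu hFE (ϖ : ℚ_[p]) (fun D ↦ h κ γ hκ hγ hγ' f hf ϖ hϖ Lplus Lminus hPP D) D'
  · intro h κ γ hκ hγ hγ' _ f hf ϖ hϖ Lplus Lminus hPP D
    obtain ⟨u, hu, hFE⟩ := exists_isUnit_invol_kobayashiL_eq_mul hp hgood hap hf hPP ε
    exact mcShape_of_inv hu hFE (ϖ : ℚ_[p]) (fun D' ↦ h κ γ hκ hγ hγ' f hf ϖ hϖ Lplus Lminus hPP D') D

/-- One direction, named: **the print-keyed (contragredient) main conjecture implies the tree-keyed one.**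
[cite: Kobayashi2003, Conjecture (Main Conjecture) (p. 2)] [cite: Sprung2017, Cor. 4.14 (a_p = 0 display)] -/
theorem kobayashiMainConjecture_of_contra (hp : p ≠ 2) (hgood : W.HasGoodReductionAtPrime p)
    (hap : W.frobeniusTrace p = 0)
    (h : ∀ (κ : ZpExtension ℚ p) (γ : Field.absoluteGaloisGroup ℚ),
          κ.IsCyclotomic → κ.IsTopGenerator γ → IsCyclotomicVariable p γ →
        ∀ [NeZero (W.conductorNorm ℤ)] (f : CuspForm (Gamma0 (W.conductorNorm ℤ)) 2),
          IsNewformOf W f → ∀ (ϖ : ℚ), (ϖ : ℝ) * W.realPeriodRat = plusPeriod f →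
        ∀ (Lplus Lminus : IwasawaAlgebra p), IsPollackPair f p Lplus Lminus →
        ∀ (D' : SignedSelmerDualData W κ γ⁻¹ ε), Module.IsTorsion (IwasawaAlgebra p) D'.X ∧
          ∃ g : IwasawaAlgebra p, D'.charIdeal = Ideal.span {g} ∧
            iwasawaToPowerSeries p g =
              PowerSeries.C (ϖ : ℚ_[p]) * iwasawaToPowerSeries p (kobayashiL ε Lplus Lminus)) :
    KobayashiMainConjecture W p ε :=
  (kobayashiMainConjecture_iff_contra W p ε hp hgood hap).2 h

/-- **KEYING DOOR FOR THE EISENSTEIN HALF.** At an odd good `p` with `a_p = 0`, `KobayashiLowerDivisibility W p ε`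
(`char X^ε = (g)`, `g^ℚ = ϖ · (L_p^ε · h)^ℚ` for every key-`γ` datum) is EQUIVALENT to the same statement over the
contragredient data `D′ : SignedSelmerDualData W κ γ⁻¹ ε`. UNCONDITIONAL.
[cite: Kobayashi2003, Conjecture (Main Conjecture) (p. 2) and Thm. 4.1 (p. 8) (the shape only)]
[cite: Sprung2017, Cor. 4.14 (a_p = 0 display)] [cite: GreenbergLNM1716, §1 (pp. 60, 67–68)] -/
theorem kobayashiLowerDivisibility_iff_contra (hp : p ≠ 2) (hgood : W.HasGoodReductionAtPrime p)
    (hap : W.frobeniusTrace p = 0) :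
    KobayashiLowerDivisibility W p ε ↔
      ∀ (κ : ZpExtension ℚ p) (γ : Field.absoluteGaloisGroup ℚ),
          κ.IsCyclotomic → κ.IsTopGenerator γ → IsCyclotomicVariable p γ →
        ∀ [NeZero (W.conductorNorm ℤ)] (f : CuspForm (Gamma0 (W.conductorNorm ℤ)) 2),
          IsNewformOf W f → ∀ (ϖ : ℚ), (ϖ : ℝ) * W.realPeriodRat = plusPeriod f →
        ∀ (Lplus Lminus : IwasawaAlgebra p), IsPollackPair f p Lplus Lminus →
        ∀ (D' : SignedSelmerDualData W κ γ⁻¹ ε),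
          ∃ g h : IwasawaAlgebra p, D'.charIdeal = Ideal.span {g} ∧
            iwasawaToPowerSeries p g =
              PowerSeries.C (ϖ : ℚ_[p]) * iwasawaToPowerSeries p (kobayashiL ε Lplus Lminus * h) := by
  constructor
  · intro h κ γ hκ hγ hγ' _ f hf ϖ hϖ Lplus Lminus hPP D'
    obtain ⟨u, -, hFE⟩ := exists_isUnit_invol_kobayashiL_eq_mul hp hgood hap hf hPP ε
    exact lowerShape_inv_of hFE (ϖ : ℚ_[p]) (fun D ↦ h κ γ hκ hγ hγ' f hf ϖ hϖ Lplus Lminus hPP D) D'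
  · intro h κ γ hκ hγ hγ' _ f hf ϖ hϖ Lplus Lminus hPP D
    obtain ⟨u, -, hFE⟩ := exists_isUnit_invol_kobayashiL_eq_mul hp hgood hap hf hPP ε
    exact lowerShape_of_inv hFE (ϖ : ℚ_[p]) (fun D' ↦ h κ γ hκ hγ hγ' f hf ϖ hϖ Lplus Lminus hPP D') D

/-- One direction, named: **the print-keyed Eisenstein half implies the tree-keyed one.**
[cite: Kobayashi2003, Conjecture (Main Conjecture) (p. 2)] [cite: Sprung2017, Cor. 4.14 (a_p = 0 display)] -/
theorem kobayashiLowerDivisibility_of_contra (hp : p ≠ 2) (hgood : W.HasGoodReductionAtPrime p)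
    (hap : W.frobeniusTrace p = 0)
    (h : ∀ (κ : ZpExtension ℚ p) (γ : Field.absoluteGaloisGroup ℚ),
          κ.IsCyclotomic → κ.IsTopGenerator γ → IsCyclotomicVariable p γ →
        ∀ [NeZero (W.conductorNorm ℤ)] (f : CuspForm (Gamma0 (W.conductorNorm ℤ)) 2),
          IsNewformOf W f → ∀ (ϖ : ℚ), (ϖ : ℝ) * W.realPeriodRat = plusPeriod f →
        ∀ (Lplus Lminus : IwasawaAlgebra p), IsPollackPair f p Lplus Lminus →
        ∀ (D' : SignedSelmerDualData W κ γ⁻¹ ε),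
          ∃ g h : IwasawaAlgebra p, D'.charIdeal = Ideal.span {g} ∧
            iwasawaToPowerSeries p g =
              PowerSeries.C (ϖ : ℚ_[p]) * iwasawaToPowerSeries p (kobayashiL ε Lplus Lminus * h)) :
    KobayashiLowerDivisibility W p ε :=
  (kobayashiLowerDivisibility_iff_contra W p ε hp hgood hap).2 h

/-- **KEYING DOOR FOR THE `p`-INVERTED `λ`-SHAPE** (the body of child 23118 `SmallImageLambdaLowerAtThree` of crux 4 and
of crux 3's `p = 3` residual, for one `(W, p, ε)`: `char X^ε = (g)`, `(p^m · g)^ℚ = ϖ · (L_p^ε · h)^ℚ`): at an odd good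
`p` with `a_p = 0` the key-`γ` statement is EQUIVALENT to the key-`γ⁻¹` one (same exponent `m`). UNCONDITIONAL.
[cite: Kobayashi2003, Conjecture (Main Conjecture) (p. 2) and Thm. 4.1 (p. 8) (the shape only)]
[cite: Sprung2017, Cor. 4.14 (a_p = 0 display)] [cite: GreenbergLNM1716, §1 (pp. 60, 67–68)] -/
theorem lambdaLowerShape_iff_contra (hp : p ≠ 2) (hgood : W.HasGoodReductionAtPrime p)
    (hap : W.frobeniusTrace p = 0) :
    (∀ (κ : ZpExtension ℚ p) (γ : Field.absoluteGaloisGroup ℚ),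
          κ.IsCyclotomic → κ.IsTopGenerator γ → IsCyclotomicVariable p γ →
        ∀ [NeZero (W.conductorNorm ℤ)] (f : CuspForm (Gamma0 (W.conductorNorm ℤ)) 2),
          IsNewformOf W f → ∀ (ϖ : ℚ), (ϖ : ℝ) * W.realPeriodRat = plusPeriod f →
        ∀ (Lplus Lminus : IwasawaAlgebra p), IsPollackPair f p Lplus Lminus →
        ∀ (D : SignedSelmerDualData W κ γ ε),
          ∃ (g h : IwasawaAlgebra p) (m : ℕ), D.charIdeal = Ideal.span {g} ∧
            iwasawaToPowerSeries p (PowerSeries.C ((p : ℤ_[p]) ^ m) * g) =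
              PowerSeries.C (ϖ : ℚ_[p]) * iwasawaToPowerSeries p (kobayashiL ε Lplus Lminus * h)) ↔
    (∀ (κ : ZpExtension ℚ p) (γ : Field.absoluteGaloisGroup ℚ),
          κ.IsCyclotomic → κ.IsTopGenerator γ → IsCyclotomicVariable p γ →
        ∀ [NeZero (W.conductorNorm ℤ)] (f : CuspForm (Gamma0 (W.conductorNorm ℤ)) 2),
          IsNewformOf W f → ∀ (ϖ : ℚ), (ϖ : ℝ) * W.realPeriodRat = plusPeriod f →
        ∀ (Lplus Lminus : IwasawaAlgebra p), IsPollackPair f p Lplus Lminus →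
        ∀ (D' : SignedSelmerDualData W κ γ⁻¹ ε),
          ∃ (g h : IwasawaAlgebra p) (m : ℕ), D'.charIdeal = Ideal.span {g} ∧
            iwasawaToPowerSeries p (PowerSeries.C ((p : ℤ_[p]) ^ m) * g) =
              PowerSeries.C (ϖ : ℚ_[p]) * iwasawaToPowerSeries p (kobayashiL ε Lplus Lminus * h)) := by
  constructor
  · intro h κ γ hκ hγ hγ' _ f hf ϖ hϖ Lplus Lminus hPP D'
    obtain ⟨u, -, hFE⟩ := exists_isUnit_invol_kobayashiL_eq_mul hp hgood hap hf hPP ε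
    exact lambdaShape_inv_of hFE (ϖ : ℚ_[p]) (fun D ↦ h κ γ hκ hγ hγ' f hf ϖ hϖ Lplus Lminus hPP D) D'
  · intro h κ γ hκ hγ hγ' _ f hf ϖ hϖ Lplus Lminus hPP D
    obtain ⟨u, -, hFE⟩ := exists_isUnit_invol_kobayashiL_eq_mul hp hgood hap hf hPP ε
    exact lambdaShape_of_inv hFE (ϖ : ℚ_[p]) (fun D' ↦ h κ γ hκ hγ hγ' f hf ϖ hϖ Lplus Lminus hPP D') D

/-- **On crux 4's domain the door is open**: `ClassX7 W p` at `p ≠ 2` with `a_p = 0` supplies the three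
hypotheses (`GoodSS ⊆ good`), so `∃ ε, KobayashiMainConjecture W p ε` — the conclusion of
`Theses.SignedLowerHalves.KobayashiMainConjectureSmallImage` — is equivalent to its contragredient twin there.
[cite: Kobayashi2003, Conjecture (Main Conjecture) (p. 2)] [cite: Sprung2017, Cor. 4.14 (a_p = 0 display)] -/
theorem exists_sign_kobayashiMainConjecture_iff_contra_of_classX7 (hp : p ≠ 2) (hX7 : ClassX7 W p)
    (hap : W.frobeniusTrace p = 0) :
    (∃ ε : ℤˣ, KobayashiMainConjecture W p ε) ↔
      ∃ ε : ℤˣ, ∀ (κ : ZpExtension ℚ p) (γ : Field.absoluteGaloisGroup ℚ),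
          κ.IsCyclotomic → κ.IsTopGenerator γ → IsCyclotomicVariable p γ →
        ∀ [NeZero (W.conductorNorm ℤ)] (f : CuspForm (Gamma0 (W.conductorNorm ℤ)) 2),
          IsNewformOf W f → ∀ (ϖ : ℚ), (ϖ : ℝ) * W.realPeriodRat = plusPeriod f →
        ∀ (Lplus Lminus : IwasawaAlgebra p), IsPollackPair f p Lplus Lminus →
        ∀ (D' : SignedSelmerDualData W κ γ⁻¹ ε), Module.IsTorsion (IwasawaAlgebra p) D'.X ∧
          ∃ g : IwasawaAlgebra p, D'.charIdeal = Ideal.span {g} ∧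
            iwasawaToPowerSeries p g =
              PowerSeries.C (ϖ : ℚ_[p]) * iwasawaToPowerSeries p (kobayashiL ε Lplus Lminus) :=
  exists_congr fun ε ↦ kobayashiMainConjecture_iff_contra W p ε hp hX7.1.1 hap

end Doors

/-! ## §4. The input side: Kobayashi's Thm. 4.1 conclusions are keying-invariant (appended) -/

section Inputs

variable {W : WeierstrassCurve ℚ} [W.IsElliptic] [W.IsGloballyMinimal] {p : ℕ} [Fact p.Prime]
  {κ : ZpExtension ℚ p} {γ : Field.absoluteGaloisGroup ℚ}

/-- **`pⁿ · L_p^ε ∈ char X^ε` is the same statement in either keying.** At an odd good `p` with `a_p = 0`, for the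
level-`N_E` newform, any Pollack pair, any sign, any key-`γ` datum `D` and any key-`γ⁻¹` datum `D′`:
`pⁿ L_p^ε ∈ char(D.X) ↔ pⁿ L_p^ε ∈ char(D′.X)` — dictionary `signedSelmerDualData_mem_charIdeal_inv_iff`
(`f ∈ char D′ ↔ ι f ∈ char D`), `ι(pⁿ L) = pⁿ · u · L` (§1 of part 1) and ideals absorb units. This is the shape of
both displays of `Kobayashi2003.thm41_signedCharIdeal_divisibility` (Thm. 4.1: `∃ n, pⁿ L ∈ Char X^ε`; `n = 0` at
surjective image), so that PUBLISHED input is keying-invariant as typed. UNCONDITIONAL.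
[cite: Kobayashi2003, Thm. 4.1 (p. 8) (the shape only)] [cite: Sprung2017, Cor. 4.14 (a_p = 0 display)]
[cite: GreenbergLNM1716, §1 (pp. 60, 67–68)] -/
theorem pow_mul_kobayashiL_mem_charIdeal_iff_contra (hp : p ≠ 2) (hgood : W.HasGoodReductionAtPrime p)
    (hap : W.frobeniusTrace p = 0) [NeZero (W.conductorNorm ℤ)] {f : CuspForm (Gamma0 (W.conductorNorm ℤ)) 2}
    (hf : IsNewformOf W f) {Lplus Lminus : IwasawaAlgebra p} (hPP : IsPollackPair f p Lplus Lminus) (ε : ℤˣ)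
    (D : SignedSelmerDualData W κ γ ε) (D' : SignedSelmerDualData W κ γ⁻¹ ε) (n : ℕ) :
    (p : IwasawaAlgebra p) ^ n * kobayashiL ε Lplus Lminus ∈ D.charIdeal ↔
      (p : IwasawaAlgebra p) ^ n * kobayashiL ε Lplus Lminus ∈ D'.charIdeal := by
  obtain ⟨u, hu, hFE⟩ := exists_isUnit_invol_kobayashiL_eq_mul hp hgood hap hf hPP ε
  rw [signedSelmerDualData_mem_charIdeal_inv_iff D D', map_mul, map_pow, map_natCast, hFE, mul_left_comm,
    Ideal.unit_mul_mem_iff_mem _ hu]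

/-- The case `n = 0`: **`L_p^ε ∈ char X^ε` is the same statement in either keying** (the surjective-image display of
Kobayashi's Thm. 4.1, and the Kato-side inclusion of his main conjecture). UNCONDITIONAL at odd good `p`, `a_p = 0`.
[cite: Kobayashi2003, Thm. 4.1 (p. 8) (the shape only)] [cite: Sprung2017, Cor. 4.14 (a_p = 0 display)] -/
theorem kobayashiL_mem_charIdeal_iff_contra (hp : p ≠ 2) (hgood : W.HasGoodReductionAtPrime p)
    (hap : W.frobeniusTrace p = 0) [NeZero (W.conductorNorm ℤ)] {f : CuspForm (Gamma0 (W.conductorNorm ℤ)) 2}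
    (hf : IsNewformOf W f) {Lplus Lminus : IwasawaAlgebra p} (hPP : IsPollackPair f p Lplus Lminus) (ε : ℤˣ)
    (D : SignedSelmerDualData W κ γ ε) (D' : SignedSelmerDualData W κ γ⁻¹ ε) :
    kobayashiL ε Lplus Lminus ∈ D.charIdeal ↔ kobayashiL ε Lplus Lminus ∈ D'.charIdeal := by
  simpa only [pow_zero, one_mul] using
    pow_mul_kobayashiL_mem_charIdeal_iff_contra hp hgood hap hf hPP ε D D' 0

/-- The first display of Thm. 4.1 (`∃ n, pⁿ L_p^ε ∈ Char X^ε`, no image hypothesis) **is the same statement in either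
keying**. UNCONDITIONAL at odd good `p`, `a_p = 0`. [cite: Kobayashi2003, Thm. 4.1 (p. 8) (the shape only)]
[cite: Sprung2017, Cor. 4.14 (a_p = 0 display)] -/
theorem exists_pow_mul_kobayashiL_mem_charIdeal_iff_contra (hp : p ≠ 2) (hgood : W.HasGoodReductionAtPrime p)
    (hap : W.frobeniusTrace p = 0) [NeZero (W.conductorNorm ℤ)] {f : CuspForm (Gamma0 (W.conductorNorm ℤ)) 2}
    (hf : IsNewformOf W f) {Lplus Lminus : IwasawaAlgebra p} (hPP : IsPollackPair f p Lplus Lminus) (ε : ℤˣ)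
    (D : SignedSelmerDualData W κ γ ε) (D' : SignedSelmerDualData W κ γ⁻¹ ε) :
    (∃ n : ℕ, (p : IwasawaAlgebra p) ^ n * kobayashiL ε Lplus Lminus ∈ D.charIdeal) ↔
      ∃ n : ℕ, (p : IwasawaAlgebra p) ^ n * kobayashiL ε Lplus Lminus ∈ D'.charIdeal :=
  exists_congr fun n ↦ pow_mul_kobayashiL_mem_charIdeal_iff_contra hp hgood hap hf hPP ε D D' n

end Inputs

end Summit.BirchSwinnertonDyer.BirchSwinnertonDyer.Theorems.KobayashiKeyingDoor

end
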